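import Summits.ResolutionOfSingularities.ResolutionOfSingularities.Theorems.StallVertexKernels
import Summits.ResolutionOfSingularities.ResolutionOfSingularities.Theorems.StallVertexClean
import Literature.AlgebraicGeometry.Resolution.PointBlowupResidueInequality
import HarnessLib

/-!
# StallVertexCarry — decomp-res node «StallVertex» (lens-5 g20 rev 5), add-on tree file 10 of the node

Content VERBATIM from the decomp-res lens-5 g20 file `HOME/decomp-res-lens-5/g20/StallVertex.lean` rev 5 (pin
5d7e6b95, 3 024 l; rev 5 SUPERSEDES rev 4 74ef32c0
and rev 3 549891b7 as landing source — insertions only, all earlier statements byte-identical; HOME =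
run/shared/lean/pub/decomp-res).  The rev-0/1/2 sections are
ALREADY in the tree (`StallVertexForms` / `Kernels` / `Walk` / `Classes` / `Clean` / `Rigid` / `Lines` /
`RigidClasses` / `MaxContactCutStallVertex`, writer g7);
these add-on files carry ONLY the declarations NEW in rev 3 / rev 4 / rev 5.  Critic: CRITIC-LEDGER rows 142c (rev
3: the old-letter law, CLEARED 2026-08-30T21:45:00Z),
142d (rev 4: the general carried-line law + line dichotomy, DECIDED +1, 22:09:45Z), 142e (rev 5: the turn law,
booked toward (S), 22:25:58Z) — landing orders INBOX
:362 / :396 / :429 (2).  Landed by decomp-res writer g8 as `StallVertexCarry` (§1d–§1e), `StallVertexOldLetter`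
(§1g + §3d–§3e), `StallVertexLineTurn` (§3f–§3g),
`StallVertexLetterClasses` (§4d–§4e classes and exact re-locations) and the wiring file
`MaxContactCutStallVertexEvents` (§4f classes + every new `closes_…` /
`defectWalksDeep_iff_…` BY NAME on `MaxContactCut.DefectWalksDeep`).  All `--supports
stmt-ResolutionOfSingularities-31770`.  Every file of the node is in the
Theses cone (the lens imports the in-cone `DifferentialShade`), so the located residual is booked on the route by
RE-LOCATING the existing aside 28122
`CFNoSkewJointTailsDeep` to `StallVertex.NoStraightEventFreeSkewStalledTailsDeep` (EXACT, hypothesis-free chain skew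
↔ vertexBound ↔ rigid ↔ lineFree ↔ letterFree ↔
eventFree ↔ straight: `skew_iff_straight`) — one aside, not two (critic: «ONE aside … SUPERSEDING the rev-4
aside; nothing else»).

§1d–§1e (rev 3, `section Algebra`): DEHOMOGENISATION AT THE DIRECTION and THE ON-PLANE LAW for cones with a
linear factor (`dehom`, `dehom_mul` / `_pow`,
`chartTransform_form_eq_aeval`, `dirForm_eq_dehom`, `constantCoeff_dehom_linear`, `ordZero_dehom_monomial`,
`eval_direction_eq_zero_of_le_ordZero_dirForm`, `one_le_ordZero_dehom_linear_of_eval_eq_zero`); THE CARRY LAW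
(`homogeneousComponent_mul_of_isHomogeneous'`,
`dehom_linear`, `constantCoeff_prod_X_add_C_pow`, `prod_X_add_C_pow_split`, `coeff_single_linear`,
`isHomogeneous_linear`, `carry_of_clean`).  PROVED, 0 sorry.
Imports the landed `StallVertexKernels` and `StallVertexClean`.  DEDUP (gate `dedup.landed`, p793615): the lens's
`flat_monomial'` restates the landed
`Literature.AlgebraicGeometry.Resolution.PointBlowup.flat_monomial` [PointBlowupResidueInequality] — the copy is
DROPPED and its three call sites
(`chartTransform_form_eq_aeval`, `ordZero_dehom_monomial`, `carry_of_clean`) cite the Literature lemma by its full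
name; nothing else changed.

[WRITER NOTE (decomp-res writer g8): file split only; namespace, opens, section variables and every declaration
exactly as in the lens (global `set_option` dropped; the lens's `set_option maxHeartbeats … in` on `turn_monomial` kept).]

(Sources: KawanoueMatsuki2016 Prop. 4 (2), §4.1; Hauser2010; HauserPerlega2024; Moh1987; CossartPiltant2008;
Giraud1975; Hironaka1964; ZariskiSamuelII Ch. VIII §2.)
-/

noncomputable section

open MvPolynomial Finset
open Literature.AlgebraicGeometry.Resolution
open Literature.AlgebraicGeometry.Resolution.Hauser2010
open Literature.AlgebraicGeometry.Resolution.HauserPerlega2024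
open Literature.Barriers.ResolutionOfSingularities
open Literature.AlgebraicGeometry.Resolution.PointBlowup
open Summit.ResolutionOfSingularities.ResolutionOfSingularities.Theses
open Summit.ResolutionOfSingularities.ResolutionOfSingularities.Theorems.TightDefectClasses
open Summit.ResolutionOfSingularities.ResolutionOfSingularities.Theorems.ProximityCut
open Summit.ResolutionOfSingularities.ResolutionOfSingularities.Theorems.ExitLaw
open Summit.ResolutionOfSingularities.ResolutionOfSingularities.Theorems.DifferentialShade

namespace Summit.ResolutionOfSingularities.ResolutionOfSingularities.Theorems.StallVertex

section Algebra

variable {σ : Type*} {K : Type*} [Field K] [Fintype σ] [DecidableEq σ]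

/-! ### §1d Dehomogenisation at the direction; THE ON-PLANE LAW for cones with a linear factor -/

/-- DEHOMOGENISE AT THE DIRECTION: `u_j ↦ 1`, then translate to the point `b` — a ring map; on a degree-`d` form it is
`translate b ∘ chartTransform d j` (`dirForm_eq_dehom`). [folklore: Hauser2010 §F] -/
noncomputable def dehom (j : σ) (b : σ → K) (P : MvPolynomial σ K) : MvPolynomial σ K :=
  PointBlowup.translate b (aeval (fun i => if i = j then (1 : MvPolynomial σ K) else X i) P)

omit [Fintype σ] in
/-- `dehom_mul`: Auxiliary step of this node's calculus, VERBATIM from the lens file (see the module docstring); the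
statement is its type. [folklore] -/
theorem dehom_mul (j : σ) (b : σ → K) (P Q : MvPolynomial σ K) :
    dehom j b (P * Q) = dehom j b P * dehom j b Q := by
  unfold dehom PointBlowup.translate; rw [map_mul, map_mul]

omit [Fintype σ] in
/-- `dehom_pow`: Auxiliary step of this node's calculus, VERBATIM from the lens file (see the module docstring); the
statement is its type. [folklore] -/
theorem dehom_pow (j : σ) (b : σ → K) (P : MvPolynomial σ K) (n : ℕ) :
    dehom j b (P ^ n) = dehom j b P ^ n := by
  unfold dehom PointBlowup.translate; rw [map_pow, map_pow]

/-- On a form of degree `d`, the chart transform at level `d` IS the dehomogenisation `u_j ↦ 1`. [folklore] -/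
theorem chartTransform_form_eq_aeval {d : ℕ} (j : σ) {Φ : MvPolynomial σ K} (hΦ : ∀ e ∈ Φ.support, e.degree = d) :
    chartTransform d j Φ = aeval (fun i => if i = j then (1 : MvPolynomial σ K) else X i) Φ := by
  classical
  conv_rhs => rw [Φ.as_sum]
  unfold chartTransform
  rw [map_sum]
  refine Finset.sum_congr rfl fun e he => ?_
  have hexp : chartExponent d j e = e.erase j := by
    ext i
    rw [chartExponent_apply, Finsupp.erase_apply]
    by_cases hij : i = j
    · rw [if_pos hij, if_pos hij, hΦ e he, Nat.sub_self]
    · rw [if_neg hij, if_neg hij]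
  rw [Literature.AlgebraicGeometry.Resolution.PointBlowup.flat_monomial, hexp]

/-- The direction form is the dehomogenisation of the initial form at the direction. [folklore] -/
theorem dirForm_eq_dehom (d : ℕ) (j : σ) (b : σ → K) (G : MvPolynomial σ K) :
    dirForm d j b G = dehom j b (homogeneousComponent d G) := by
  unfold dirForm dehom
  rw [chartTransform_form_eq_aeval j (fun e he => degree_eq_of_mem_support_homogeneousComponent he)]

/-- The constant term of the dehomogenised LINEAR FORM `H = Σ cᵢ uᵢ` is its value at the direction `b[j ↦
1]`. [folklore] -/
theorem constantCoeff_dehom_linear (j : σ) (b : σ → K) (c : σ → K) :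
    constantCoeff (dehom j b (∑ i, C (c i) * X i)) = ∑ i, c i * Function.update b j 1 i := by
  unfold dehom
  rw [constantCoeff_translate, map_sum, map_sum]
  refine Finset.sum_congr rfl fun i _ => ?_
  rw [map_mul, aeval_C, aeval_X, algebraMap_eq, map_mul, eval_C]
  by_cases hij : i = j
  · subst hij; rw [if_pos rfl, map_one, Function.update_self]
  · rw [if_neg hij, eval_X, Function.update_of_ne hij]

/-- The dehomogenised-translated monomial `r·u^s` has order = its KEPT CONTENT: the exponents at the coordinates
`i ≠ j` with `b_i = 0` (the chart coordinate becomes `1`, the translated ones become units `(u_i + b_i)^{s_i}`). [folklore] -/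
theorem ordZero_dehom_monomial [DecidableEq K] (j : σ) (b : σ → K) (s : σ →₀ ℕ) {r : K} (hr : r ≠ 0) :
    ordZero (dehom j b (monomial s r)) = ((∑ i ∈ univ.filter (fun i => ¬ (i = j ∨ b i ≠ 0)), s i : ℕ) : ℕ∞) := by
  unfold dehom
  rw [Literature.AlgebraicGeometry.Resolution.PointBlowup.flat_monomial, WeightedBlowup.translate_monomial, ordZero_C_mul hr, ordZero_prod, Nat.cast_sum,
    ← Finset.sum_filter_add_sum_filter_not univ (fun i => ¬ (i = j ∨ b i ≠ 0))]
  have hzero : ∑ i ∈ univ.filter (fun i => ¬¬ (i = j ∨ b i ≠ 0)),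
      ordZero ((X i + C (b i)) ^ ((s.erase j) i) : MvPolynomial σ K) = 0 := by
    refine Finset.sum_eq_zero fun i hi => ?_
    rw [Finset.mem_filter, not_not] at hi
    rcases hi.2 with hij | hbi
    · rw [hij, Finsupp.erase_same, pow_zero, ordZero_one]
    · rw [ordZero_pow, (ordZero_eq_zero_iff _).mpr, mul_zero]
      rw [map_add, constantCoeff_X, constantCoeff_C, zero_add]; exact hbi
  rw [hzero, add_zero]
  refine Finset.sum_congr rfl fun i hi => ?_
  rw [Finset.mem_filter, not_or, not_not] at hi
  rw [Finsupp.erase_ne hi.2.1, hi.2.2, C_0, add_zero, ordZero_X_pow]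

/-- **THE ON-PLANE LAW (algebraic).**  If the initial form of `G` is `M · H^γ` with `H = Σ cᵢuᵢ` LINEAR and `γ > 0`,
and the vertex order exceeds what the cofactor can contribute by at least `γ` (`ord₀ (dehom M) + γ ≤ ord₀ dirForm`),
then THE DIRECTION LIES ON THE PLANE `{H = 0}`: `Σ cᵢ δᵢ = 0`, `δ = b[j ↦ 1]` (otherwise `dehom H` is a unit and the
`H^γ` factor contributes nothing to the vertex order). [new] [folklore] -/
theorem eval_direction_eq_zero_of_le_ordZero_dirForm {d : ℕ} (j : σ) (b : σ → K) {G M : MvPolynomial σ K}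
    (c : σ → K) {γ : ℕ} (hγ : 0 < γ) (hG : homogeneousComponent d G = M * (∑ i, C (c i) * X i) ^ γ)
    (hM : dehom j b M ≠ 0) (hle : ordZero (dehom j b M) + (γ : ℕ∞) ≤ ordZero (dirForm d j b G)) :
    ∑ i, c i * Function.update b j 1 i = 0 := by
  by_contra hne
  have h0 : ordZero (dehom j b (∑ i, C (c i) * X i)) = 0 := by
    rw [ordZero_eq_zero_iff, constantCoeff_dehom_linear]; exact hne
  rw [dirForm_eq_dehom, hG, dehom_mul, dehom_pow, ordZero_mul, ordZero_pow, h0, mul_zero, add_zero] at hle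
  obtain ⟨k, hk⟩ := exists_ordZero_eq_natCast hM
  rw [hk, ← Nat.cast_add, Nat.cast_le] at hle
  omega

/-- Conversely, ON the plane the dehomogenised linear form has order at least one (no constant term). [folklore] -/
theorem one_le_ordZero_dehom_linear_of_eval_eq_zero (j : σ) (b : σ → K) (c : σ → K)
    (h : ∑ i, c i * Function.update b j 1 i = 0) : 1 ≤ ordZero (dehom j b (∑ i, C (c i) * X i)) := by
  rw [one_le_ordZero_iff, constantCoeff_dehom_linear]; exact h

/-! ### §1e THE CARRY LAW: through a clean on-plane move the cone `r·u^s·H^γ` becomes `r'·u^{s♭}·(H♭)^γ`,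
`H♭ = H(u_j ↦ 0)` -/

omit [Fintype σ] [DecidableEq σ] in
/-- For `ℓ` homogeneous of degree `i`: `in_{i+n}(ℓ·Q) = ℓ·in_n(Q)` (graded structure of `MvPolynomial`; proof as in the
tree file `FrobeniusClosingSteerArithResidueLift`). [folklore] -/
theorem homogeneousComponent_mul_of_isHomogeneous' {ℓ : MvPolynomial σ K} {i : ℕ} (hℓ : ℓ.IsHomogeneous i)
    (Q : MvPolynomial σ K) (n : ℕ) :
    homogeneousComponent (i + n) (ℓ * Q) = ℓ * homogeneousComponent n Q := by
  classical
  letI : GradedAlgebra (homogeneousSubmodule σ K) := MvPolynomial.gradedAlgebra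
  have h := DirectSum.coe_decompose_mul_add_of_left_mem (𝒜 := homogeneousSubmodule σ K) (b := Q) (j := n)
    ((mem_homogeneousSubmodule i ℓ).mpr hℓ)
  rw [← DirectSum.Decomposition.decompose'_eq, decomposition.decompose'_apply, decomposition.decompose'_apply] at h
  exact h

/-- The dehomogenised LINEAR FORM: `dehom (Σ cᵢuᵢ) = (Σ cᵢδᵢ) + Σᵢ c[j ↦ 0]ᵢ uᵢ` — constant
term = the value at the
direction, linear part = THE CARRIED FUNCTIONAL `c[j ↦ 0]` (one `carryLine` step). [new reading] [folklore] -/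
theorem dehom_linear (j : σ) (b : σ → K) (c : σ → K) :
    dehom j b (∑ i, C (c i) * X i) =
      C (∑ i, c i * Function.update b j 1 i) + ∑ i, C (Function.update c j 0 i) * X i := by
  unfold dehom PointBlowup.translate
  simp only [map_sum, map_mul, aeval_C, algebraMap_eq]
  rw [← Finset.sum_add_distrib]
  refine Finset.sum_congr rfl fun i _ => ?_
  by_cases hij : i = j
  · subst hij
    rw [aeval_X, if_pos rfl, map_one, mul_one, Function.update_self, C_1, mul_one, Function.update_self, C_0,
      zero_mul, add_zero]
  · rw [aeval_X, if_neg hij, aeval_X, Function.update_of_ne hij, Function.update_of_ne hij, mul_add, add_comm]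

omit [Fintype σ] [DecidableEq σ] in
/-- The constant term of `∏_{i ∈ S} (uᵢ + bᵢ)^{eᵢ}` is `∏_{i ∈ S} bᵢ^{eᵢ}`. [folklore] -/
theorem constantCoeff_prod_X_add_C_pow (b : σ → K) (e : σ →₀ ℕ) (S : Finset σ) :
    constantCoeff (∏ i ∈ S, (X i + C (b i) : MvPolynomial σ K) ^ (e i)) = ∏ i ∈ S, b i ^ (e i) := by
  rw [map_prod]
  refine Finset.prod_congr rfl fun i _ => ?_
  rw [map_pow, map_add, constantCoeff_X, constantCoeff_C, zero_add]

omit [DecidableEq σ] in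
/-- `∏ᵢ (uᵢ + bᵢ)^{eᵢ} = u^{e♭} · ∏_{bᵢ ≠ 0} (uᵢ + bᵢ)^{eᵢ}` with `e♭ = e|_{bᵢ = 0}`: a
MONOMIAL times a UNIT at the origin.
[folklore] -/
theorem prod_X_add_C_pow_split [DecidableEq K] (b : σ → K) (e : σ →₀ ℕ) :
    ∏ i, (X i + C (b i) : MvPolynomial σ K) ^ (e i) =
      monomial (e.filter (fun i => b i = 0)) 1 *
        ∏ i ∈ univ.filter (fun i => b i ≠ 0), (X i + C (b i) : MvPolynomial σ K) ^ (e i) := by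
  rw [← Finset.prod_filter_mul_prod_filter_not univ (fun i => b i = 0)]
  congr 1
  rw [monomial_eq, C_1, one_mul, Finsupp.prod_fintype _ _ (fun i => pow_zero _), Finset.prod_filter]
  refine Finset.prod_congr rfl fun i _ => ?_
  rw [Finsupp.filter_apply]
  by_cases hbi : b i = 0
  · rw [if_pos hbi, if_pos hbi, hbi, C_0, add_zero]
  · rw [if_neg hbi, if_neg hbi, pow_zero]

/-- The coefficient of `u_i` in the linear form `Σ cₖuₖ` is `cᵢ`. [folklore] -/
theorem coeff_single_linear (c : σ → K) (i : σ) :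
    coeff (Finsupp.single i 1) (∑ k, C (c k) * X k : MvPolynomial σ K) = c i := by
  rw [coeff_sum, Finset.sum_eq_single i]
  · rw [coeff_C_mul, coeff_X, if_pos rfl, mul_one]
  · intro k _ hk
    rw [coeff_C_mul, show (X k : MvPolynomial σ K) = monomial (Finsupp.single k 1) 1 from rfl, coeff_monomial,
      if_neg (fun hkk => hk (Finsupp.single_left_injective one_ne_zero hkk)), mul_zero]
  · intro h; exact absurd (Finset.mem_univ _) h

omit [DecidableEq σ] in
/-- A linear form is homogeneous of degree one. [folklore] -/
theorem isHomogeneous_linear (c : σ → K) : (∑ k, C (c k) * X k : MvPolynomial σ K).IsHomogeneous 1 := by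
  refine IsHomogeneous.sum _ _ _ fun i _ => ?_
  simpa using (isHomogeneous_C σ (c i)).mul (isHomogeneous_X (R := K) i)

/-- **THE CARRY LAW (algebraic, one clean move).**  Let `G` have order `d` and initial form `r·u^s·H^γ` with
`H = Σ cᵢuᵢ` linear, let the move `(j, b)` (`b_j = 0`, level `a ≤ d`) be ON THE PLANE (`Σ cᵢδᵢ = 0`),
CLEAN for `G`,
and let the carried functional `c♭ = c[j ↦ 0]` be non-zero.  Then the transform `G' = translate b (chartTransform a j G)`
has order `(d − a) + |s♭| + γ` and initial form `(r·u)·u_j^{d−a}·u^{s♭}·(H♭)^γ` with `H♭ = Σ c♭ᵢuᵢ`,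
`s♭ = (s ∖ j)|_{bᵢ = 0}` and a unit `u = ∏_{bᵢ ≠ 0} bᵢ^{sᵢ}`: THE SAME SHAPE, the young monomial
re-booked and THE LINE
CARRIED (`carryLine` step).  [new] [folklore] -/
theorem carry_of_clean [DecidableEq K] (b : σ → K) {j : σ} (hbj : b j = 0) {a d : ℕ} (had : a ≤ d)
    {G : MvPolynomial σ K} (hd : ordZero G = d) (s : σ →₀ ℕ) {r : K} (hr : r ≠ 0) (c : σ → K) (γ : ℕ)
    (hG : homogeneousComponent d G = monomial s r * (∑ i, C (c i) * X i) ^ γ)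
    (hon : ∑ i, c i * Function.update b j 1 i = 0) (hcb : ∃ i, Function.update c j 0 i ≠ 0)
    (hcl : CleanMove d j b G) :
    ordZero (PointBlowup.translate b (chartTransform a j G)) =
        ((d - a + (((s.erase j).filter (fun i => b i = 0)).degree + γ) : ℕ) : ℕ∞) ∧
      homogeneousComponent (d - a + (((s.erase j).filter (fun i => b i = 0)).degree + γ))
          (PointBlowup.translate b (chartTransform a j G)) =
        monomial (Finsupp.single j (d - a) + (s.erase j).filter (fun i => b i = 0))
            (r * ∏ i ∈ univ.filter (fun i => b i ≠ 0), b i ^ ((s.erase j) i)) *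
          (∑ i, C (Function.update c j 0 i) * X i) ^ γ := by
  classical
  obtain ⟨U, hUdef⟩ : ∃ U : MvPolynomial σ K,
      U = ∏ i ∈ univ.filter (fun i => b i ≠ 0), (X i + C (b i) : MvPolynomial σ K) ^ ((s.erase j) i) := ⟨_, rfl⟩
  obtain ⟨L, hLdef⟩ : ∃ L : MvPolynomial σ K, L = ∑ i, C (Function.update c j 0 i) * X i := ⟨_, rfl⟩
  obtain ⟨sf, hsfdef⟩ : ∃ sf : σ →₀ ℕ, sf = (s.erase j).filter (fun i => b i = 0) := ⟨_, rfl⟩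
  rw [← hLdef, ← hsfdef]
  have hu0 : (∏ i ∈ univ.filter (fun i => b i ≠ 0), b i ^ ((s.erase j) i)) ≠ 0 :=
    Finset.prod_ne_zero_iff.mpr fun i hi => pow_ne_zero _ (Finset.mem_filter.mp hi).2
  have hUc : constantCoeff U = ∏ i ∈ univ.filter (fun i => b i ≠ 0), b i ^ ((s.erase j) i) := by
    rw [hUdef]; exact constantCoeff_prod_X_add_C_pow b _ _
  have hU0 : ordZero U = 0 := by rw [ordZero_eq_zero_iff, hUc]; exact hu0
  -- the dehomogenised cofactor and the carried line
  have hM : dehom j b (monomial s r) = monomial sf r * U := by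
    unfold dehom
    rw [Literature.AlgebraicGeometry.Resolution.PointBlowup.flat_monomial, WeightedBlowup.translate_monomial, prod_X_add_C_pow_split, ← hUdef, ← hsfdef, ← mul_assoc,
      C_mul_monomial, mul_one]
  have hLd : dehom j b (∑ i, C (c i) * X i) = L := by
    rw [dehom_linear, hon, C_0, zero_add, hLdef]
  have hLhom : L.IsHomogeneous 1 := by rw [hLdef]; exact isHomogeneous_linear _
  obtain ⟨i₁, hi₁⟩ := hcb
  have hLne : L ≠ 0 := by
    intro h0
    have h1 := coeff_single_linear (Function.update c j 0) i₁
    rw [← hLdef, h0, coeff_zero] at h1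
    exact hi₁ h1.symm
  have hL1 : ordZero L = 1 := by rw [ordZero_of_isHomogeneous hLhom hLne, Nat.cast_one]
  have hLγ : (L ^ γ).IsHomogeneous γ := by simpa using hLhom.pow γ
  -- the direction form, its order and its initial form
  have hdir : dirForm d j b G = monomial sf r * U * L ^ γ := by
    rw [dirForm_eq_dehom, hG, dehom_mul, dehom_pow, hM, hLd]
  have hn : ordZero (dirForm d j b G) = ((sf.degree + γ : ℕ) : ℕ∞) := by
    rw [hdir, ordZero_mul, ordZero_mul, ordZero_monomial _ hr, hU0, add_zero, ordZero_pow, hL1, mul_one, Nat.cast_add]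
  have hsfhom : (monomial sf r : MvPolynomial σ K).IsHomogeneous sf.degree := isHomogeneous_monomial _ rfl
  have hin : homogeneousComponent (sf.degree + γ) (dirForm d j b G) =
      monomial sf (r * ∏ i ∈ univ.filter (fun i => b i ≠ 0), b i ^ ((s.erase j) i)) * L ^ γ := by
    rw [hdir, mul_comm (monomial sf r * U) (L ^ γ), show sf.degree + γ = γ + (sf.degree + 0) by omega,
      homogeneousComponent_mul_of_isHomogeneous' hLγ, homogeneousComponent_mul_of_isHomogeneous' hsfhom,
      homogeneousComponent_zero, ← constantCoeff_eq, hUc, mul_comm ((monomial sf) r) (C _), C_mul_monomial, mul_comm r,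
      mul_comm (L ^ γ)]
  refine ⟨ordZero_move_of_clean b hbj had hd hn hcl, ?_⟩
  rw [initialForm_move_of_clean b hbj had hd hn hcl, hin, ← mul_assoc, X_pow_eq_monomial, monomial_mul, one_mul]

end Algebra

end Summit.ResolutionOfSingularities.ResolutionOfSingularities.Theorems.StallVertex
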